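import Summits.CriticalPhenomena.PercolationContinuityZ3.Theorems.PercNearOneGluingAdditiveGluingFQsharpBFingerCex
import HarnessLib

/-! # Crux `PercNearOneGluing.AdditiveGluing` (stmt-CriticalPhenomena-4576) — the contact-deletion step Q♯ is FALSE even at a UNIQUE weakest contact:
# a certified weighted counterexample on seven vertices (seat (b) V⁺-form, `png-dp-vplus`, gen 8)

Support file (`--supports stmt-CriticalPhenomena-4576`); no definitions of mathematical content (the `def`s are witness data and computable
checkers), no named facts, no sorries, standard axioms (the arithmetic is kernel `decide`, not `native_decide`).

Memo MEMO-gen7 §0(2) proposed, besides the finger-deletion step FQ♯, the CONTACT-deletion step of the linear-certificate route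
(`linearCert_split_step` with `F₁ = F_u` = the pairs from the block `N` to the τ_K-weakest contact relay `u`):

  (Q♯)  `Δ_K(F_u) − μ_K(R_{F_u})·h ≥ μ_K(R_{F_u}ᶜ)·max(0, h − h')`,

`R_{F_u}` = "some pair of `F_u` open", `Δ_K(F) = μ_K(R_F ∩ {d↮N} ∩ ⋃_{v∈N}{v↔b}) − μ_K(R_F ∩ {d↮N} ∩ {d↔b})`, `h = μ_K(u↔b) − μ_K(d↔b)` (the least
slack, `u` weakest), `h'` = the least slack over the active contacts of the weighting with the pairs `N–u` killed.  The ttrl census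
(run/shared/lean/ttrl/setG/QSHARP.md; 509 M exact instances) found Q♯ violated in 2 731 designations — 342 of them with a UNIQUE weakest
contact — so Q♯ is not a universal step in any form (unlike FQ♯ at fingers not wired to `b`, 0 violations).

**THIS FILE CERTIFIES THE SMALLEST UNIQUE-ARGMIN VIOLATION** (kernel reduction, exact rationals): `Fin 7`, `b = 0`, `d = 1`, `N = {2, 3}`,
relays `A = {0, 1, 4, 5, 6}`; weights `K(0,4) = K(0,5) = K(0,6) = 1/2`, `K(1,4) = 15/16`, `K(1,5) = 1/2`, `K(2,5) = 1/2`, `K(2,6) = 3/4`,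
`K(3,4) = 1/2`, `K(4,6) = 1/2`, all other pairs `0` (no pair at `b` from the block, no inner pair).  Then
`μ_K(5↔b) = 737/1024 < μ_K(6↔b) = 742/1024 < μ_K(4↔b) = 754/1024`: `u = 5` is the UNIQUE weakest contact, `μ_K(d↔b) = 2929/4096`,
`h = 19/4096`; killing the pairs `N–5` leaves the contacts `4` (via `3`) and `6` (via `2`) with `μ(6↔b) = 335/512 ≤ μ(4↔b) = 365/512`,
`μ(d↔b) = 353/512`, so `h' = −9/256`; `Δ_K(F_u) = 141/4096 − 60/4096 = 81/4096`, `μ_K(R_{F_u}) = 1/2`; and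
`Δ − μ(R)·h − μ(Rᶜ)·max(0, h − h') = −5/2048 < 0` (`not_Qsharp_uniqueArgmin`).
Conjecture G, L1/L2 and the finger step FQ♯ (not wired to `b`) are NOT touched (here `margin_K(d) = 21/1024 > 0`).
[cite: KozmaNitzan2024, Thm 4 and Lemma 5 (§3.2, pp. 12–14)]
-/

namespace Summit.CriticalPhenomena.PercolationContinuityZ3.Theorems

open MeasureTheory Set
open Literature.Probability.LatticeModels Literature.Probability.Percolation
open Summit.CriticalPhenomena.PercolationContinuityZ3.Theorems.AdditiveGluing.Negative.Cert
open Summit.CriticalPhenomena.PercolationContinuityZ3.Theorems.FQsharpBFingerCex (real_eq_wcountL)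

noncomputable section
open Classical

namespace QsharpUniqueArgminCex

/-! ### The witness -/

/-- The witness weights on `Fin 7` (`b = 0`, `d = 1`, `N = {2,3}`, contacts `4, 5, 6`). -/
def witQ : List (Fin 7 × Fin 7 × ℚ) :=
  [(0, 4, 1/2), (0, 5, 1/2), (0, 6, 1/2), (1, 4, 15/16), (1, 5, 1/2), (2, 5, 1/2), (2, 6, 3/4), (3, 4, 1/2), (4, 6, 1/2)]

/-- The witness with the pairs `N–5` killed. -/
def witQ' : List (Fin 7 × Fin 7 × ℚ) :=
  [(0, 4, 1/2), (0, 5, 1/2), (0, 6, 1/2), (1, 4, 15/16), (1, 5, 1/2), (2, 6, 3/4), (3, 4, 1/2), (4, 6, 1/2)]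

/-- The listed pairs of the witness are distinct. [this file] -/
theorem witQ_nodup : (wPairs witQ).Nodup := by decide

/-- The witness weights lie in `[0, 1]`. [this file] -/
theorem witQ_weights : ∀ e ∈ witQ, 0 ≤ e.2.2 ∧ e.2.2 ≤ 1 := by
  intro e he
  simp only [witQ, List.mem_cons, List.not_mem_nil, or_false] at he
  rcases he with rfl | rfl | rfl | rfl | rfl | rfl | rfl | rfl | rfl <;> norm_num

/-- The listed pairs of the killed list are distinct. [this file] -/
theorem witQ'_nodup : (wPairs witQ').Nodup := by decide

/-- The killed weights lie in `[0, 1]`. [this file] -/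
theorem witQ'_weights : ∀ e ∈ witQ', 0 ≤ e.2.2 ∧ e.2.2 ≤ 1 := by
  intro e he
  simp only [witQ', List.mem_cons, List.not_mem_nil, or_false] at he
  rcases he with rfl | rfl | rfl | rfl | rfl | rfl | rfl | rfl <;> norm_num

/-- **Killing the pairs `N–5` gives `wOfList witQ'`.** [this file] -/
theorem killWeight_eq :
    (fun e' : Sym2 (Fin 7) => if (∃ v ∈ ({2, 3} : Finset (Fin 7)), e' = s(v, (5 : Fin 7))) then (0 : unitInterval)
      else wOfList witQ e') = wOfList witQ' := by
  funext x
  induction x using Sym2.ind with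
  | _ i j =>
    fin_cases i <;> fin_cases j <;> simp [wOfList, witQ, witQ', mkE]

/-! ### The events as `Bool` tests -/

/-- some pair `N–5` is open (read on the edge list). -/
def ruB (ω : List (Fin 7 × Fin 7)) : Bool :=
  decide (∃ v ∈ ({2, 3} : Finset (Fin 7)), s(v, (5 : Fin 7)) ∈ Eset ω)

/-- `d ↮ N` and some block vertex `↔ b` (read on the reach table). -/
def muB (tb : List ℕ) : Bool :=
  decide ((∀ x ∈ ({2, 3} : Finset (Fin 7)), (tb.getD ((1 : Fin 7) : ℕ) 0).testBit (x : ℕ) = false) ∧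
    ∃ v ∈ ({2, 3} : Finset (Fin 7)), (tb.getD (v : ℕ) 0).testBit ((0 : Fin 7) : ℕ) = true)

/-- `d ↮ N` and `d ↔ b` (read on the reach table). -/
def mxB (tb : List ℕ) : Bool :=
  decide ((∀ x ∈ ({2, 3} : Finset (Fin 7)), (tb.getD ((1 : Fin 7) : ℕ) 0).testBit (x : ℕ) = false) ∧
    (tb.getD ((1 : Fin 7) : ℕ) 0).testBit ((0 : Fin 7) : ℕ) = true)

/-- Exact count of `R_u ∩ ({d↮N} ∩ ⋃_{v∈N}{v↔b})`. -/
def cntRMU : ℚ := ((wsubs witQ).map fun c => if ruB c.1 && muB (reachTable 7 c.1) then c.2 else 0).sum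

/-- Exact count of `R_u ∩ ({d↮N} ∩ {d↔b})`. -/
def cntRMX : ℚ := ((wsubs witQ).map fun c => if ruB c.1 && mxB (reachTable 7 c.1) then c.2 else 0).sum

/-- Exact count of `R_u`. -/
def cntR : ℚ := ((wsubs witQ).map fun c => if ruB c.1 then c.2 else 0).sum

/-- Exact count of `R_uᶜ`. -/
def cntRc : ℚ := ((wsubs witQ).map fun c => if !(ruB c.1) then c.2 else 0).sum

/-- `μ_K(R_u ∩ ({d↮N} ∩ ⋃_{v∈N}{v↔b})) = cntRMU`. [this file] -/
theorem real_RMU :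
    (prodBernoulli (wOfList witQ)).real
        ({ω : Set (Sym2 (Fin 7)) | ∃ e ∈ ({2, 3} : Finset (Fin 7)).image (fun v : Fin 7 => s(v, (5 : Fin 7))), e ∈ ω} ∩
          ({ω : BondConfig (Fin 7) | ∀ x ∈ (↑({2, 3} : Finset (Fin 7)) : Set (Fin 7)), ¬ (openGraph ω).Reachable 1 x} ∩
            ⋃ v ∈ ({2, 3} : Finset (Fin 7)), openConn v 0)) = (cntRMU : ℝ) := by
  refine real_eq_wcountL witQ_nodup witQ_weights (fun ω => ruB ω && muB (reachTable 7 ω)) _ fun ω => ?_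
  simp only [Bool.and_eq_true, ruB, muB, decide_eq_true_eq, Set.mem_inter_iff, Set.mem_setOf_eq, Finset.mem_coe, Finset.mem_image,
    Bool.eq_false_iff, ne_eq, testBit_reachTable_iff_mem_openConn, openConn, Set.mem_iUnion, exists_prop, Finset.mem_coe]
  constructor
  · rintro ⟨⟨v, hv, he⟩, hM, hU⟩
    exact ⟨⟨s(v, (5 : Fin 7)), ⟨v, hv, rfl⟩, he⟩, hM, hU⟩
  · rintro ⟨⟨e, ⟨v, hv, rfl⟩, he⟩, hM, hU⟩
    exact ⟨⟨v, hv, he⟩, hM, hU⟩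

/-- `μ_K(R_u ∩ ({d↮N} ∩ {d↔b})) = cntRMX`. [this file] -/
theorem real_RMX :
    (prodBernoulli (wOfList witQ)).real
        ({ω : Set (Sym2 (Fin 7)) | ∃ e ∈ ({2, 3} : Finset (Fin 7)).image (fun v : Fin 7 => s(v, (5 : Fin 7))), e ∈ ω} ∩
          ({ω : BondConfig (Fin 7) | ∀ x ∈ (↑({2, 3} : Finset (Fin 7)) : Set (Fin 7)), ¬ (openGraph ω).Reachable 1 x} ∩
            openConn (1 : Fin 7) 0)) = (cntRMX : ℝ) := by
  refine real_eq_wcountL witQ_nodup witQ_weights (fun ω => ruB ω && mxB (reachTable 7 ω)) _ fun ω => ?_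
  simp only [Bool.and_eq_true, ruB, mxB, decide_eq_true_eq, Set.mem_inter_iff, Set.mem_setOf_eq, Finset.mem_coe, Finset.mem_image,
    Bool.eq_false_iff, ne_eq, testBit_reachTable_iff_mem_openConn, openConn]
  constructor
  · rintro ⟨⟨v, hv, he⟩, hM, hX⟩
    exact ⟨⟨s(v, (5 : Fin 7)), ⟨v, hv, rfl⟩, he⟩, hM, hX⟩
  · rintro ⟨⟨e, ⟨v, hv, rfl⟩, he⟩, hM, hX⟩
    exact ⟨⟨v, hv, he⟩, hM, hX⟩

/-- `μ_K(R_u) = cntR`. [this file] -/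
theorem real_R :
    (prodBernoulli (wOfList witQ)).real
        {ω : Set (Sym2 (Fin 7)) | ∃ e ∈ ({2, 3} : Finset (Fin 7)).image (fun v : Fin 7 => s(v, (5 : Fin 7))), e ∈ ω} =
      (cntR : ℝ) := by
  refine real_eq_wcountL witQ_nodup witQ_weights ruB _ fun ω => ?_
  simp only [ruB, decide_eq_true_eq, Set.mem_setOf_eq, Finset.mem_coe, Finset.mem_image]
  constructor
  · rintro ⟨v, hv, he⟩
    exact ⟨s(v, (5 : Fin 7)), ⟨v, hv, rfl⟩, he⟩
  · rintro ⟨e, ⟨v, hv, rfl⟩, he⟩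
    exact ⟨v, hv, he⟩

/-- `μ_K(R_uᶜ) = cntRc`. [this file] -/
theorem real_Rc :
    (prodBernoulli (wOfList witQ)).real
        ({ω : Set (Sym2 (Fin 7)) | ∃ e ∈ ({2, 3} : Finset (Fin 7)).image (fun v : Fin 7 => s(v, (5 : Fin 7))), e ∈ ω}ᶜ :
          Set (BondConfig (Fin 7))) = (cntRc : ℝ) := by
  refine real_eq_wcountL witQ_nodup witQ_weights (fun ω => !(ruB ω)) _ fun ω => ?_
  simp only [Bool.not_eq_true', ruB, decide_eq_false_iff_not, Set.mem_compl_iff, Set.mem_setOf_eq, Finset.mem_coe, Finset.mem_image,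
    not_exists, not_and]
  constructor
  · intro h e ⟨v, hv, hev⟩ he
    exact h v hv (hev ▸ he)
  · intro h v hv he
    exact h _ ⟨v, hv, rfl⟩ he

/-! ### The arithmetic (exact rational counts over `2⁹` resp. `2⁸` configurations, kernel `decide`) -/

/-- The facts: `5` is the UNIQUE weakest contact of `K` (strictly below `4` and `6`), `6` is the weakest active contact of the killed
weighting, and the violated step: with `h = μ_K(5↔b) − μ_K(d↔b)`, `h' = μ_{K'}(6↔b) − μ_{K'}(d↔b)`,
`cntRMU − cntRMX − cntR·h < cntRc·max(0, h − h')`. [this file] -/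
theorem facts :
    wConn (wtabs 7 witQ) 5 0 < wConn (wtabs 7 witQ) 4 0 ∧ wConn (wtabs 7 witQ) 5 0 < wConn (wtabs 7 witQ) 6 0 ∧
    wConn (wtabs 7 witQ') 6 0 ≤ wConn (wtabs 7 witQ') 4 0 ∧
    cntRMU - cntRMX - cntR * (wConn (wtabs 7 witQ) 5 0 - wConn (wtabs 7 witQ) 1 0) <
      cntRc * max 0 ((wConn (wtabs 7 witQ) 5 0 - wConn (wtabs 7 witQ) 1 0) -
        (wConn (wtabs 7 witQ') 6 0 - wConn (wtabs 7 witQ') 1 0)) := by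
  decide +kernel

end QsharpUniqueArgminCex

open QsharpUniqueArgminCex

/-- **The contact-deletion step Q♯ is FALSE, even at a unique weakest contact.**  The negated statement: stub setting (`b, d, u ∈ A`, block `N`
disjoint from `A`, no pairs `N–b`, `N–d`, no inner pairs, fingers free off `A`), `u ≠ b` the UNIQUE minimiser of `μ_K(·↔b)` among the active
contact relays, `h = μ_K(u↔b) − μ_K(d↔b)`, `h'` the least slack `μ(a↔b) − μ(d↔b)` over the active contacts of the weighting with the pairs `N–u`
killed; claim `Δ_K(F_u) − μ_K(R_{F_u})·h ≥ μ_K(R_{F_u}ᶜ)·max(0, h − h')` (`F_u` = the pairs `N–u`).  It fails at the seven-vertex witness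
`witQ` with `u = 5` (margin `−5/2048`; `QsharpUniqueArgminCex.facts`). [this file] -/
theorem not_Qsharp_uniqueArgmin :
    ¬ (∀ (n : ℕ) (K : Sym2 (Fin n) → unitInterval) (A N : Finset (Fin n)) (d b u : Fin n) (h h' : ℝ),
      b ∈ A → d ∈ A → u ∈ A → u ≠ b → Disjoint N A →
      (∀ v ∈ N, (K s(v, b) : ℝ) = 0) → (∀ v ∈ N, (K s(v, d) : ℝ) = 0) →
      (∀ v ∈ N, ∀ v' ∈ N, v ≠ v' → (K s(v, v') : ℝ) = 0) →
      (∀ v ∈ N, ∀ y : Fin n, y ∉ A → y ∉ N → (K s(v, y) : ℝ) = 0) →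
      (∃ v ∈ N, (K s(v, u) : ℝ) ≠ 0) →
      (∀ a ∈ A, a ≠ b → a ≠ u → (∃ v ∈ N, (K s(v, a) : ℝ) ≠ 0) →
        (prodBernoulli K).real (openConn u b) < (prodBernoulli K).real (openConn a b)) →
      h = (prodBernoulli K).real (openConn u b) - (prodBernoulli K).real (openConn d b) →
      ((∀ a ∈ A, a ≠ b → (∃ v ∈ N, a ≠ u ∧ (K s(v, a) : ℝ) ≠ 0) →
          h' ≤ (prodBernoulli (fun e' : Sym2 (Fin n) => if (∃ v ∈ N, e' = s(v, u)) then (0 : unitInterval) else K e')).real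
                  (openConn a b) -
                (prodBernoulli (fun e' : Sym2 (Fin n) => if (∃ v ∈ N, e' = s(v, u)) then (0 : unitInterval) else K e')).real
                  (openConn d b)) ∧
        (∃ a ∈ A, a ≠ b ∧ (∃ v ∈ N, a ≠ u ∧ (K s(v, a) : ℝ) ≠ 0) ∧
          h' = (prodBernoulli (fun e' : Sym2 (Fin n) => if (∃ v ∈ N, e' = s(v, u)) then (0 : unitInterval) else K e')).real
                  (openConn a b) -
                (prodBernoulli (fun e' : Sym2 (Fin n) => if (∃ v ∈ N, e' = s(v, u)) then (0 : unitInterval) else K e')).real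
                  (openConn d b))) →
      (prodBernoulli K).real ({ω : Set (Sym2 (Fin n)) | ∃ e ∈ N.image (fun v : Fin n => s(v, u)), e ∈ ω} ∩
            ({ω : BondConfig (Fin n) | ∀ x ∈ (↑N : Set (Fin n)), ¬ (openGraph ω).Reachable d x} ∩ ⋃ v ∈ N, openConn v b)) -
          (prodBernoulli K).real ({ω : Set (Sym2 (Fin n)) | ∃ e ∈ N.image (fun v : Fin n => s(v, u)), e ∈ ω} ∩
            ({ω : BondConfig (Fin n) | ∀ x ∈ (↑N : Set (Fin n)), ¬ (openGraph ω).Reachable d x} ∩ openConn d b)) -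
          (prodBernoulli K).real {ω : Set (Sym2 (Fin n)) | ∃ e ∈ N.image (fun v : Fin n => s(v, u)), e ∈ ω} * h ≥
        (prodBernoulli K).real ({ω : Set (Sym2 (Fin n)) | ∃ e ∈ N.image (fun v : Fin n => s(v, u)), e ∈ ω}ᶜ :
            Set (BondConfig (Fin n))) * max 0 (h - h')) := by
  intro hall
  obtain ⟨h54, h56, h64', hviol⟩ := facts
  have hτ : ∀ x : Fin 7, (prodBernoulli (wOfList witQ)).real (openConn x 0) = (wConn (wtabs 7 witQ) x 0 : ℝ) :=
    fun x => real_openConn_eq_wConn witQ_nodup witQ_weights x 0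
  have hτ4 : (prodBernoulli (wOfList witQ)).real (openConn (4 : Fin 7) 0) = (wConn (wtabs 7 witQ) 4 0 : ℝ) := hτ 4
  have hτ5 : (prodBernoulli (wOfList witQ)).real (openConn (5 : Fin 7) 0) = (wConn (wtabs 7 witQ) 5 0 : ℝ) := hτ 5
  have hτ6 : (prodBernoulli (wOfList witQ)).real (openConn (6 : Fin 7) 0) = (wConn (wtabs 7 witQ) 6 0 : ℝ) := hτ 6
  have hτ1 : (prodBernoulli (wOfList witQ)).real (openConn (1 : Fin 7) 0) = (wConn (wtabs 7 witQ) 1 0 : ℝ) := hτ 1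
  have hτ' : ∀ x : Fin 7, (prodBernoulli (fun e' : Sym2 (Fin 7) => if (∃ v ∈ ({2, 3} : Finset (Fin 7)), e' = s(v, (5 : Fin 7)))
      then (0 : unitInterval) else wOfList witQ e')).real (openConn x 0) = (wConn (wtabs 7 witQ') x 0 : ℝ) := by
    intro x; rw [killWeight_eq]; exact real_openConn_eq_wConn witQ'_nodup witQ'_weights x 0
  have hτ'4 : (prodBernoulli (fun e' : Sym2 (Fin 7) => if (∃ v ∈ ({2, 3} : Finset (Fin 7)), e' = s(v, (5 : Fin 7)))
      then (0 : unitInterval) else wOfList witQ e')).real (openConn (4 : Fin 7) 0) = (wConn (wtabs 7 witQ') 4 0 : ℝ) := hτ' 4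
  have hτ'6 : (prodBernoulli (fun e' : Sym2 (Fin 7) => if (∃ v ∈ ({2, 3} : Finset (Fin 7)), e' = s(v, (5 : Fin 7)))
      then (0 : unitInterval) else wOfList witQ e')).real (openConn (6 : Fin 7) 0) = (wConn (wtabs 7 witQ') 6 0 : ℝ) := hτ' 6
  have hτ'1 : (prodBernoulli (fun e' : Sym2 (Fin 7) => if (∃ v ∈ ({2, 3} : Finset (Fin 7)), e' = s(v, (5 : Fin 7)))
      then (0 : unitInterval) else wOfList witQ e')).real (openConn (1 : Fin 7) 0) = (wConn (wtabs 7 witQ') 1 0 : ℝ) := hτ' 1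
  have h54R : (wConn (wtabs 7 witQ) 5 0 : ℝ) < (wConn (wtabs 7 witQ) 4 0 : ℝ) := by exact_mod_cast h54
  have h56R : (wConn (wtabs 7 witQ) 5 0 : ℝ) < (wConn (wtabs 7 witQ) 6 0 : ℝ) := by exact_mod_cast h56
  have h64R : (wConn (wtabs 7 witQ') 6 0 : ℝ) ≤ (wConn (wtabs 7 witQ') 4 0 : ℝ) := by exact_mod_cast h64'
  -- pairs of the block to `b`, `d`, `5` and inside
  have hnob : ∀ v ∈ ({2, 3} : Finset (Fin 7)), (wOfList witQ s(v, 0) : ℝ) = 0 := by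
    intro v hv
    simp only [Finset.mem_insert, Finset.mem_singleton] at hv
    rcases hv with rfl | rfl <;> simp [wOfList, witQ, mkE]
  have hnod : ∀ v ∈ ({2, 3} : Finset (Fin 7)), (wOfList witQ s(v, 1) : ℝ) = 0 := by
    intro v hv
    simp only [Finset.mem_insert, Finset.mem_singleton] at hv
    rcases hv with rfl | rfl <;> simp [wOfList, witQ, mkE]
  have h25 : (wOfList witQ s((2 : Fin 7), 5) : ℝ) ≠ 0 := by
    have : wOfList witQ s((2 : Fin 7), 5) = Set.projIcc (0 : ℝ) 1 zero_le_one ((1/2 : ℚ) : ℝ) := by simp [wOfList, witQ, mkE]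
    rw [this]; norm_num [Set.projIcc]
  have h26 : (wOfList witQ s((2 : Fin 7), 6) : ℝ) ≠ 0 := by
    have : wOfList witQ s((2 : Fin 7), 6) = Set.projIcc (0 : ℝ) 1 zero_le_one ((3/4 : ℚ) : ℝ) := by simp [wOfList, witQ, mkE]
    rw [this]; norm_num [Set.projIcc]
  have key := hall 7 (wOfList witQ) {0, 1, 4, 5, 6} {2, 3} 1 0 5
    ((wConn (wtabs 7 witQ) 5 0 - wConn (wtabs 7 witQ) 1 0 : ℚ) : ℝ)
    ((wConn (wtabs 7 witQ') 6 0 - wConn (wtabs 7 witQ') 1 0 : ℚ) : ℝ)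
    (by decide) (by decide) (by decide) (by decide) (by decide) hnob hnod
    (by
      intro v hv v' hv' hvv'
      simp only [Finset.mem_insert, Finset.mem_singleton] at hv hv'
      rcases hv with rfl | rfl <;> rcases hv' with rfl | rfl <;> first | exact absurd rfl hvv' | simp [wOfList, witQ, mkE])
    (by
      intro v _ y hyA hyN
      exfalso
      revert y
      decide)
    ⟨2, by decide, h25⟩
    (by
      intro a ha hab hau hact
      simp only [Finset.mem_insert, Finset.mem_singleton] at ha
      rcases ha with rfl | rfl | rfl | rfl | rfl
      · exact absurd rfl hab
      · exfalso
        obtain ⟨v, hv, hne⟩ := hact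
        exact hne (hnod v hv)
      · rw [hτ5, hτ4]; exact h54R
      · exact absurd rfl hau
      · rw [hτ5, hτ6]; exact h56R)
    (by rw [hτ5, hτ1]; push_cast; ring)
    (by
      refine ⟨?_, ⟨6, by decide, by decide, ⟨2, by decide, by decide, h26⟩, ?_⟩⟩
      · intro a ha hab hact
        simp only [Finset.mem_insert, Finset.mem_singleton] at ha
        rcases ha with rfl | rfl | rfl | rfl | rfl
        · exact absurd rfl hab
        · exfalso
          obtain ⟨v, hv, -, hne⟩ := hact
          exact hne (hnod v hv)
        · rw [hτ'4, hτ'1]; push_cast; linarith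
        · exfalso
          obtain ⟨v, hv, hne, -⟩ := hact
          exact hne rfl
        · rw [hτ'6, hτ'1]; push_cast; linarith
      · rw [hτ'6, hτ'1]; push_cast; ring)
  rw [real_RMU, real_RMX, real_R, real_Rc] at key
  have key' : cntRc * max 0 ((wConn (wtabs 7 witQ) 5 0 - wConn (wtabs 7 witQ) 1 0) -
        (wConn (wtabs 7 witQ') 6 0 - wConn (wtabs 7 witQ') 1 0)) ≤
      cntRMU - cntRMX - cntR * (wConn (wtabs 7 witQ) 5 0 - wConn (wtabs 7 witQ) 1 0) := by
    have := key
    push_cast at this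
    exact_mod_cast this
  exact absurd key' (not_le.2 hviol)

end

end Summit.CriticalPhenomena.PercolationContinuityZ3.Theorems
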